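import Summits.QuantumFields.YangMills.Theorems.BalabanUVNodesN15NeumannCubeAveragingDefect
import Summits.QuantumFields.YangMills.Theorems.BalabanUVNodesN15NeumannCubeConvolutionDefect
import Summits.QuantumFields.YangMills.Theorems.BalabanUVNodesN15TwoGridLandauDefectFull
import HarnessLib

/-!
# Route «BalabanUVNodes» (K3⁷), node N15 = NE2, -a lane, PROGRAMME N file N-IIm: THE η-DEFECT OF THE CUBE PROPAGATOR BEHIND THE NONLOCAL PART `N_L = a•Q*Q − ∂Π∂*` OF `Δ_a` —
# dag-n15-c WANT-n15-a (g12-4) `hasMaj_idef_chiCube_nonlocal_neumannCubeG`, hypothesis-free on the torus family (part 2 of 2: the Landau half and the assembly)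

Cell `pub-ymgap`, seat `pub-ymgap-dag-n15-a` (KNIT-BY-NAME, g21; D-0062; chair R424 venue; `bears_on: R4∕N15`); `--kind proof --supports stmt-QuantumFields-20544 --as helper`.
Over N-IIl `…NeumannCubeAveragingDefect` (★★★ `hasMaj_idef_chiCube_qq_neumannCubeG_of`: the `Q*Q` half — `Q*Q` commutes with the images, N-IIg's sandwich with the own-direction stencil row),
N-IIk `…NeumannCubeConvolutionDefect` (★★★ `hasMaj_idef_chiCube_comp_neumannCubeG_of`: ANY operator pair with a fine letter and a two-grid defect letter behind the cube — here `T₁ := V = ∂Π∂*`),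
part 41 `hasMaj_landauRe` ((1.126) as a block majorant, both grids) and part 47ff `hasMaj_landauDefect_family` (`𝔇(V′, V) ≤ C(L^k)^{−γ∕2}e^{−δd}`).  dag-n15-c g12 I.31964 WANT-n15-a (g12-4):
«FILE 75's r₃ supplier takes `hIY : 𝔇(M_{χ′}∘N_L′∘G′(□), M_χ∘N_L∘G(□)) ≤ 1_□1_□·r·e^{−ρd}`, `N_L = a•(qvAdjRe∘qvRe) + (−landauRe)`, both members images cubes on the doubled torus; ASK
`hasMaj_idef_chiCube_nonlocal_neumannCubeG` in N-IIc's family form — with it the U ≡ 1 two-grid composition certificate closes on the doubled torus (FILES 77∕78)».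

WHAT.  §40 `idef_chiCube_smul_add_neg_comp` (the η-defect is linear in the operator pair), ★★★ `hasMaj_idef_chiCube_nonlocal_neumannCubeG_of` — LETTERS AS HYPOTHESES (any torus `M_ν = 2S`,
`n = L^k`, `n′ = L^r·n`): the torus letters `G ≤ Ce^{−δ₀d}` (`hG`), `𝔇(G′,G) ≤ C₀e^{−δ₀d}` (`h0`), `∇_νG ≤ C₁e^{−δ₀d}` (`h1`), the Landau letters `V′ ≤ a_Ve^{−ρ₁d}` (`hV`), `𝔇(V′,V) ≤ r_Ve^{−ρ₁d}`
(`hDV`), a row sum `c_r` at `σ` (`ρ ≤ δ₀`, `ρ + σ ≤ ρ₁`) give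
  `𝔇(χ′_□∘(a•Q*′Q′ − V′)∘G′(□), χ_□∘(a•Q*Q − V)∘G(□)) ≤ 1_□(y)1_□(y′)·(a·K_Q + K_V)·e^{−ρ|y−y′|_T}`,
`K_Q = 2^{d+1}e^{δ₀}e^{2δ₀}(C₀ + (C₁ + 4C)∕L^k)` (N-IIl), `K_V = 2^{d+1}e^{δ₀}c_r(a_VC₀ + a_V(d+1)C₁∕L^k + r_VC)` (N-IIk verbatim).  §41 ★★★ `hasMaj_idef_chiCube_nonlocal_neumannCubeG` — THE ASK,
HYPOTHESIS-FREE in N-IIc's family form: for odd `L ≥ 3`, `a > 0`, `0 < γ < 1` there are `δ, m > 0` such that for EVERY `m_T`, `k ≥ 1`, `r`, corner `c` of `Tor (MP (paramsOf d L m_T k hL))`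
(torus `2L^{m_T}`, cube side `L^{m_T}`): `… ≤ 1_□(y)1_□(y′)·m·(L^k)^{−γ∕2}·e^{−δ|y−y′|_T}` — programme N's constants (`hasMaj_gOp`, `hasMaj_entries110`, `hasMaj_twoGridDefect`, `hasMaj_landauRe`,
`hasMaj_landauDefect_family`) plugged, `1∕L^k ≤ (L^k)^{−γ∕2}`.
WHY THE SPLIT (located, for the record).  N-IIk's route needs a two-grid OPERATOR letter `𝔇(T₁′, T₁)` for `Q*Q` on rough inputs (v1.0.2: it HAS one, at rate `η` — N-IIs
`hasMaj_idef_qvAdjRe_qvRe_rough`, `…TwoGridAveragingDefectRough`; the earlier «does not have» was too pessimistic); routes through the dressed kernel `N_L∘G = 1 − Δ∘G`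
(`Δ_aG = 1`) meet the identity, whose cut images sandwich has an O(1) two-grid defect on the `L^r`-slab under the seam (`𝔇(M_{χ′°}, M_{χ°}) = (χ′° − χ°∘pr)·P`).  Splitting `N_L` BEFORE the
images avoids both: `V` has genuine letters ((1.126) + part 47), and `Q*Q` commutes with the images EXACTLY so that only the OWN-direction difference of the `Q*` stencil (= linear interpolation
along the line, `O(η)`) enters the face term (N-IIl).
HONEST FRAMING.  Block-majorant bookkeeping over LANDED letters; no new analytic estimate; `U ≡ 1` torus MODEL of [B5] §1 on the doubled-cube tori (ONE-CUBE model; the multi-cube ∕ record-torus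
transport is programme P, whose Landau half is P-IIh `hasMaj_idef_chiCube_comp_liftCubeG_of` with `T₁ := landauRe`); [B9] Thm 3.14 = difference TEMPLATE only; nothing of [B6] (2.38)–(2.40) ∕ [B9]
asserted; N15 NOT discharged (object-bound; NE2⁺ NOT PRINTED); counts UNMOVED (typed 28∕28 · discharged 5∕27); finite tori — NOT continuum ∕ ℝ⁴ ∕ OS ∕ mass gap ∕ Clay.  Theorems only (0 def).
v1.0.1 (doc only): King's Prop. 3.9 locator p.665 (ref-B READ-818 NIT-L1 on N-IIl, same string here).  v1.0.2 (doc only): the «WHY THE SPLIT» aside corrected — `a•Q*Q` does have a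
two-grid operator letter on rough inputs (N-IIs); the split remains the route of record here (it needs no such letter).
-/

noncomputable section

open scoped BigOperators Matrix
open Finset

namespace Summit.QuantumFields.YangMills.BalabanUVNodes.N15.TwoGrid

open Literature.MathematicalPhysics.QuantumFieldTheory.Balaban1983to89
open Literature.MathematicalPhysics.QuantumFieldTheory.Balaban1983to89.B5Prop11Plancherel (Tor fine unitVec)
open Literature.MathematicalPhysics.QuantumFieldTheory.Balaban1983to89.B6Prop26Gluing (mulOp mulOp_apply ind ind_nonneg ind_le_one)
open Literature.MathematicalPhysics.QuantumFieldTheory.King1986.Torus (blockOf tdistT tdistT_symm tdistT_nonneg)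
open Literature.MathematicalPhysics.QuantumFieldTheory.Balaban1983to89.B11SectG (BlockNorm HasMaj)
open Literature.MathematicalPhysics.QuantumFieldTheory.Balaban1983to89.B6UnitTorusCarrier (unitTorusGeo)
open Literature.MathematicalPhysics.QuantumFieldTheory.Balaban1983to89.T4EtaRateDefect (idef idef_comp idef_apply)
open Literature.MathematicalPhysics.QuantumFieldTheory.Balaban1983to89.T4EtaRateCoeffDefect (pull pull_apply)
open Summit.QuantumFields.YangMills.BalabanUVNodes.N15.VectorPiece (blkFine kingPr kingPrV blkFine_comp_kingPrV)

variable {d : ℕ}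

/-! ## §40 The Landau half (N-IIk verbatim) and the assembly: the η-defect of the cube propagator behind `N_L = a•Q*Q − ∂Π∂*` -/

section Assembly

open Literature.MathematicalPhysics.QuantumFieldTheory.Balaban1983to89.B6RandomWalk (Triangle254)
open Literature.MathematicalPhysics.QuantumFieldTheory.Balaban1983to89.B11SectG (RowSum)

variable {L : ℕ} [NeZero L] {M : Fin (d + 1) → ℕ} [∀ μ, NeZero (M μ)] {k r : ℕ} {c : Tor M} {S : ℕ}

/-- the η-defect is linear in the operator pair: `𝔇(χ′(a•A′ + (−B′))N′, χ(a•A + (−B))N) = a•𝔇(χ′A′N′, χAN) + (−𝔇(χ′B′N′, χBN))`. [folklore] -/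
theorem idef_chiCube_smul_add_neg_comp {X₁ X₂ : Type} (P : X₂ → X₁) (χ : X₁ → ℝ) (χ' : X₂ → ℝ) (a : ℝ) (A B N : Module.End ℝ (X₁ → ℝ)) (A' B' N' : Module.End ℝ (X₂ → ℝ)) :
    idef (pull P) (pull P) (mulOp χ' ∘ₗ ((a • A' + (-B')) ∘ₗ N')) (mulOp χ ∘ₗ ((a • A + (-B)) ∘ₗ N)) =
      a • idef (pull P) (pull P) (mulOp χ' ∘ₗ (A' ∘ₗ N')) (mulOp χ ∘ₗ (A ∘ₗ N)) + (-idef (pull P) (pull P) (mulOp χ' ∘ₗ B' ∘ₗ N') (mulOp χ ∘ₗ B ∘ₗ N)) := by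
  refine LinearMap.ext fun f => funext fun x => ?_
  simp only [idef_apply, LinearMap.comp_apply, LinearMap.add_apply, LinearMap.smul_apply, LinearMap.neg_apply, mulOp_apply, map_add, map_smul, map_neg,
    Pi.add_apply, Pi.smul_apply, Pi.neg_apply, Pi.sub_apply, pull_apply, smul_eq_mul]
  ring

/-- ★★★ **THE η-DEFECT OF THE CUBE PROPAGATOR BEHIND THE NONLOCAL PART `N_L = a•Q*Q − ∂Π∂*` OF `Δ_a` — dag-n15-c WANT-n15-a (g12-4), LETTERS AS HYPOTHESES** (any torus `M_ν = 2S`,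
`n = L^k`, `n′ = L^r·n`, King's `P` on both sides).  INPUTS: the torus letters `G ≤ Ce^{−δ₀d}` (`hG`), `𝔇(G′,G) ≤ C₀e^{−δ₀d}` (`h0`), `∇_νG ≤ C₁e^{−δ₀d}` (`h1`); the Landau letters
`V′ ≤ a_Ve^{−ρ₁d}` (`hV`, (1.126)) and `𝔇(V′, V) ≤ r_Ve^{−ρ₁d}` (`hDV`, part 47's two-grid defect of `∂Π∂*`); a row sum `c_r` at `σ`, `ρ ≤ δ₀`, `ρ + σ ≤ ρ₁`.  OUTPUT:
`𝔇(χ′_□∘N_L′∘G′(□), χ_□∘N_L∘G(□)) ≤ 1_□(y)1_□(y′)·(a·K_Q + K_V)·e^{−ρ|y−y′|_T}`, `K_Q = 2^{d+1}e^{δ₀}e^{2δ₀}(C₀ + (C₁ + 4C)∕L^k)` (N-IIl: `Q*Q` commutes with the images; the sandwich),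
`K_V = 2^{d+1}e^{δ₀}c_r(a_VC₀ + a_V(d+1)C₁∕L^k + r_VC)` (N-IIk VERBATIM with `T₁ := V`).
[cite: Balaban1985BackgroundPropagators, Thm 3.14 pp.426–427 (difference template), (3.42) p.397 (shape); Balaban1984PropagatorsII, (2.37) p.229 (images), Lemma 2.1 (2.61)–(2.62) p.234,
(2.133)–(2.134) p.247 (shapes); Balaban1984PropagatorsI, (1.18) p.20, (1.69)–(1.70) pp.29–30, Prop. 1.2 (1.110) p.35, (1.126) p.38; King1986, Prop. 3.9 p.665 (η-rate shape)] -/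
theorem hasMaj_idef_chiCube_nonlocal_neumannCubeG_of (hM : ∀ ν, M ν = 2 * S) {a : ℝ} (ha : 0 < a) {C C₀ C₁ δ₀ aV rV ρ₁ ρ σ cr : ℝ}
    (htri : Triangle254 (unitTorusGeo L k M)) (hrow : RowSum (unitTorusGeo L k M) σ cr) (hC : 0 ≤ C) (hC₀ : 0 ≤ C₀) (hC₁ : 0 ≤ C₁) (hδ₀ : 0 ≤ δ₀) (haV : 0 ≤ aV) (hrV : 0 ≤ rV)
    (hρ : 0 ≤ ρ) (hρδ : ρ ≤ δ₀) (hρσ : ρ + σ ≤ ρ₁)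
    (hG : HasMaj (BlockNorm.ofBlocks (unitTorusGeo L k M) (fun b : Tor (fine (L ^ k) M) × Fin (d + 1) => blockOf (L ^ k) M b.1))
      (BlockNorm.ofBlocks (unitTorusGeo L k M) (fun b : Tor (fine (L ^ k) M) × Fin (d + 1) => blockOf (L ^ k) M b.1)) (gOp M (L ^ k) a)
      (fun y y' => C * Real.exp (-(δ₀ * tdistT M y y'))))
    (h0 : HasMaj (BlockNorm.ofBlocks (unitTorusGeo L k M) (fun b : Tor (fine (L ^ k) M) × Fin (d + 1) => blockOf (L ^ k) M b.1))
      (BlockNorm.ofBlocks (unitTorusGeo L k M) (fun b' : Tor (fine (L ^ r * L ^ k) M) × Fin (d + 1) => blockOf (L ^ r * L ^ k) M b'.1))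
      (idef (pull (kingPrV L k r M)) (pull (kingPrV L k r M)) (gOp M (L ^ r * L ^ k) a) (gOp M (L ^ k) a)) (fun y y' => C₀ * Real.exp (-(δ₀ * tdistT M y y'))))
    (h1 : ∀ ν, HasMaj (BlockNorm.ofBlocks (unitTorusGeo L k M) (fun b : Tor (fine (L ^ k) M) × Fin (d + 1) => blockOf (L ^ k) M b.1))
      (BlockNorm.ofBlocks (unitTorusGeo L k M) (fun b : Tor (fine (L ^ k) M) × Fin (d + 1) => blockOf (L ^ k) M b.1))
      (symbOp M (L ^ k) (sD M (L ^ k) ν ((L ^ k : ℕ) : ℝ)) ∘ₗ gOp M (L ^ k) a) (fun y y' => C₁ * Real.exp (-(δ₀ * tdistT M y y'))))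
    (hV : HasMaj (BlockNorm.ofBlocks (unitTorusGeo L k M) (fun b' : Tor (fine (L ^ r * L ^ k) M) × Fin (d + 1) => blockOf (L ^ r * L ^ k) M b'.1))
      (BlockNorm.ofBlocks (unitTorusGeo L k M) (fun b' : Tor (fine (L ^ r * L ^ k) M) × Fin (d + 1) => blockOf (L ^ r * L ^ k) M b'.1)) (landauRe M (L ^ r * L ^ k))
      (fun y y' => aV * Real.exp (-(ρ₁ * tdistT M y y'))))
    (hDV : HasMaj (BlockNorm.ofBlocks (unitTorusGeo L k M) (fun b : Tor (fine (L ^ k) M) × Fin (d + 1) => blockOf (L ^ k) M b.1))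
      (BlockNorm.ofBlocks (unitTorusGeo L k M) (fun b' : Tor (fine (L ^ r * L ^ k) M) × Fin (d + 1) => blockOf (L ^ r * L ^ k) M b'.1))
      (idef (pull (kingPrV L k r M)) (pull (kingPrV L k r M)) (landauRe M (L ^ r * L ^ k)) (landauRe M (L ^ k))) (fun y y' => rV * Real.exp (-(ρ₁ * tdistT M y y')))) :
    HasMaj (BlockNorm.ofBlocks (unitTorusGeo L k M) (fun b : Tor (fine (L ^ k) M) × Fin (d + 1) => blockOf (L ^ k) M b.1))
      (BlockNorm.ofBlocks (unitTorusGeo L k M) (fun b' : Tor (fine (L ^ r * L ^ k) M) × Fin (d + 1) => blockOf (L ^ r * L ^ k) M b'.1))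
      (idef (pull (kingPrV L k r M)) (pull (kingPrV L k r M))
        (mulOp (chiCube M (L ^ r * L ^ k) c S) ∘ₗ
          ((a • (qvAdjRe M (L ^ r * L ^ k) ∘ₗ qvRe M (L ^ r * L ^ k)) + (-landauRe M (L ^ r * L ^ k))) ∘ₗ neumannCubeG M (L ^ r * L ^ k) c S a))
        (mulOp (chiCube M (L ^ k) c S) ∘ₗ ((a • (qvAdjRe M (L ^ k) ∘ₗ qvRe M (L ^ k)) + (-landauRe M (L ^ k))) ∘ₗ neumannCubeG M (L ^ k) c S a)))
      (fun y y' => ind (cubeBlocks M c S : Set (Tor M)) y * ind (cubeBlocks M c S : Set (Tor M)) y' *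
        ((a * (2 ^ (d + 1) * Real.exp δ₀ * (Real.exp δ₀ * Real.exp δ₀ * (C₀ + (C₁ + 4 * C) / (L ^ k : ℕ)))) +
          2 ^ (d + 1) * Real.exp δ₀ * cr * (aV * C₀ + aV * ((d + 1) * (C₁ / (L ^ k : ℕ))) + rV * C)) * Real.exp (-(ρ * tdistT M y y')))) := by
  have hcr : 0 ≤ cr := hrow.nonneg c
  have hQ := hasMaj_idef_chiCube_qq_neumannCubeG_of (r := r) (c := c) hM ha hC hC₀ hC₁ hδ₀ hG h0 h1
  have hΛ := hasMaj_idef_chiCube_comp_neumannCubeG_of (c := c) hM ha htri hrow hC hC₀ hC₁ hδ₀ haV hrV hρ hρδ hρσ hG h0 h1 hV hDV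
  have hKQ0 : ∀ y y' : Tor M, 0 ≤ ind (g := unitTorusGeo L k M) (cubeBlocks M c S : Set (Tor M)) y * ind (g := unitTorusGeo L k M) (cubeBlocks M c S : Set (Tor M)) y' *
      (2 ^ (d + 1) * Real.exp δ₀ * (Real.exp δ₀ * Real.exp δ₀ * (C₀ + (C₁ + 4 * C) / (L ^ k : ℕ))) * Real.exp (-(δ₀ * tdistT M y y'))) :=
    fun y y' => mul_nonneg (mul_nonneg (ind_nonneg _ _) (ind_nonneg _ _)) (by positivity)
  rw [idef_chiCube_smul_add_neg_comp]
  refine ((hasMaj_smul_ofBlocks _ hKQ0 a hQ).add hΛ.neg).mono fun y y' => ?_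
  have hE : Real.exp (-(δ₀ * tdistT M y y')) ≤ Real.exp (-(ρ * tdistT M y y')) := Real.exp_le_exp.mpr (by nlinarith [tdistT_nonneg M y y'])
  have hI : 0 ≤ ind (g := unitTorusGeo L k M) (cubeBlocks M c S : Set (Tor M)) y * ind (g := unitTorusGeo L k M) (cubeBlocks M c S : Set (Tor M)) y' :=
    mul_nonneg (ind_nonneg _ _) (ind_nonneg _ _)
  have hKQ : 0 ≤ 2 ^ (d + 1) * Real.exp δ₀ * (Real.exp δ₀ * Real.exp δ₀ * (C₀ + (C₁ + 4 * C) / (L ^ k : ℕ))) := by positivity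
  rw [abs_of_pos ha]
  have h1' := mul_le_mul_of_nonneg_left (mul_le_mul_of_nonneg_left hE hKQ) (mul_nonneg ha.le hI)
  nlinarith [h1', hI, hKQ]

end Assembly

/-! ## §41 WANT-n15-a (g12-4) on the torus family of record, programme N's constants plugged: hypothesis-free, uniform -/

section Family

open Literature.MathematicalPhysics.QuantumFieldTheory.Balaban1983to89.B5SiteBridgeP12 (MP)
open Literature.MathematicalPhysics.QuantumFieldTheory.Balaban1983to89.B6UnitTorusCarrier (triangle254_unitTorusGeo rowSum_unitTorusGeo)

variable {L : ℕ} [NeZero L]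

/-- ★★★ **dag-n15-c WANT-n15-a (g12-4): THE η-DEFECT OF THE CUBE PROPAGATOR BEHIND `N_L = a•Q*Q − ∂Π∂*`, HYPOTHESIS-FREE ON THE TORUS FAMILY** (doubled-cube tori `M_ν = 2L^{m_T} = 2S`,
cube side `S` (so `S = L^{m_T}`, in whatever spelling the consumer needs: `L^{m+1}` or `L·L^m`), coarse `n = L^k` with `k ≥ 1`, refinement `n′ = L^r·n`, any corner `c`): for odd `L ≥ 3`, `a > 0`, `0 < γ < 1` there are `δ, m > 0` with
`𝔇(χ′_□∘(a•Q*′Q′ − V′)∘G′(□ + c), χ_□∘(a•Q*Q − V)∘G(□ + c)) ≤ 1_□(y)1_□(y′)·m·(L^k)^{−γ∕2}·e^{−δ|y−y′|_T}` — the LAST operator-side socket of the two-grid remainder row of the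
U ≡ 1 composition certificate (their FILE 75 `hIY`).  Constants: part 39 `hasMaj_gOp` ∕ `hasMaj_entries110` ((1.110)), part 52ff `hasMaj_twoGridDefect` (King's rate), part 41
`hasMaj_landauRe` ((1.126)), part 47ff `hasMaj_landauDefect_family`; `1∕L^k ≤ (L^k)^{−γ∕2}`.
[cite: Balaban1985BackgroundPropagators, Thm 3.14 pp.426–427, (3.42) p.397 (shape); Balaban1984PropagatorsII, (2.37) p.229, Lemma 2.1 (2.61)–(2.62) p.234, (2.133)–(2.134) p.247;
Balaban1984PropagatorsI, (1.18) p.20, (1.69)–(1.70) pp.29–30, Prop. 1.2 (1.110) p.35, (1.126) p.38; King1986, Prop. 3.8 (3.71) p.664, Prop. 3.9 (3.73) p.665] -/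
theorem hasMaj_idef_chiCube_nonlocal_neumannCubeG (hLodd : Odd L) (hL2 : 2 ≤ L) {a : ℝ} (ha : 0 < a) {γ : ℝ} (hγ0 : 0 < γ) (hγ1 : γ < 1) :
    ∃ δ m : ℝ, 0 < δ ∧ 0 < m ∧ ∀ (mT k r : ℕ) (hk : 1 ≤ k) (hL : Odd L ∧ 1 < L) (S : ℕ) (hS : ∀ ν, MP (paramsOf d L mT k hL) ν = 2 * S)
      (c : Tor (MP (paramsOf d L mT k hL))),
      HasMaj (BlockNorm.ofBlocks (unitTorusGeo L k (MP (paramsOf d L mT k hL))) (blkFine L k (MP (paramsOf d L mT k hL))))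
        (BlockNorm.ofBlocks (unitTorusGeo L k (MP (paramsOf d L mT k hL)))
          (fun i : Tor (fine (L ^ r * L ^ k) (MP (paramsOf d L mT k hL))) × Fin (d + 1) => blockOf (L ^ r * L ^ k) (MP (paramsOf d L mT k hL)) i.1))
        (idef (pull (kingPrV L k r (MP (paramsOf d L mT k hL)))) (pull (kingPrV L k r (MP (paramsOf d L mT k hL))))
          (mulOp (chiCube (MP (paramsOf d L mT k hL)) (L ^ r * L ^ k) c S) ∘ₗ
            ((a • (qvAdjRe (MP (paramsOf d L mT k hL)) (L ^ r * L ^ k) ∘ₗ qvRe (MP (paramsOf d L mT k hL)) (L ^ r * L ^ k)) +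
                (-landauRe (MP (paramsOf d L mT k hL)) (L ^ r * L ^ k))) ∘ₗ
              neumannCubeG (MP (paramsOf d L mT k hL)) (L ^ r * L ^ k) c S a))
          (mulOp (chiCube (MP (paramsOf d L mT k hL)) (L ^ k) c S) ∘ₗ
            ((a • (qvAdjRe (MP (paramsOf d L mT k hL)) (L ^ k) ∘ₗ qvRe (MP (paramsOf d L mT k hL)) (L ^ k)) + (-landauRe (MP (paramsOf d L mT k hL)) (L ^ k))) ∘ₗ
              neumannCubeG (MP (paramsOf d L mT k hL)) (L ^ k) c S a)))
        (fun y y' => ind ((cubeBlocks (MP (paramsOf d L mT k hL)) c S : Finset _) : Set _) y *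
          ind ((cubeBlocks (MP (paramsOf d L mT k hL)) c S : Finset _) : Set _) y' *
          (m * ((L ^ k : ℕ) : ℝ) ^ (-(γ / 2)) * Real.exp (-(δ * tdistT (MP (paramsOf d L mT k hL)) y y')))) := by
  have hL : Odd L ∧ 1 < L := ⟨hLodd, by omega⟩
  obtain ⟨δG, CG, hδG, hCG, HG⟩ := hasMaj_gOp (d := d) hL ha
  obtain ⟨δD, CD, hδD, hCD, H0⟩ := hasMaj_twoGridDefect (d := d) hLodd hL2 ha hγ0 hγ1
  obtain ⟨δ₁, C₁, hδ₁, hC₁, H1⟩ := hasMaj_entries110 (d := d) hL ha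
  obtain ⟨δΛ, CΛ, hδΛ, hCΛ, HΛ⟩ := hasMaj_landauRe (d := d) (L := L)
  obtain ⟨δLD, CLD, hδLD, hCLD, HLD⟩ := hasMaj_landauDefect_family (d := d) hLodd hL2 ha hγ0 hγ1
  -- rates: `δ₀` for the torus data, `ρ₁` for the Landau letters, output `ρ`, row sum at `σ = ρ₁∕2`
  set δ₀ : ℝ := min δG (min δD δ₁) with hδ₀def
  have hδ₀ : 0 < δ₀ := lt_min hδG (lt_min hδD hδ₁)
  set ρ₁ : ℝ := min δΛ δLD with hρ₁def
  have hρ₁ : 0 < ρ₁ := lt_min hδΛ hδLD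
  set σ : ℝ := ρ₁ / 2 with hσdef
  have hσ : 0 < σ := by positivity
  set ρ : ℝ := min δ₀ (ρ₁ / 2) with hρdef
  have hρ : 0 < ρ := lt_min hδ₀ (by positivity)
  set cr : ℝ := B4Sect5Proof.latticeConst (d + 1) σ with hcrdef
  have hcr : 0 ≤ cr := (rowSum_unitTorusGeo (L := L) (k := 1) (M := MP (paramsOf d L 0 1 hL)) hσ).nonneg 0
  set m : ℝ := 2 ^ (d + 1) * Real.exp δ₀ * (a * (Real.exp δ₀ * Real.exp δ₀ * (CD + (C₁ + 4 * CG))) + cr * (CΛ * CD + CΛ * ((d + 1) * C₁) + CLD * CG)) + 1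
    with hmdef
  have hm : 0 < m := by positivity
  refine ⟨ρ, m, hρ, hm, fun mT k r hk hL' S hS c => ?_⟩
  have hn1 : 1 ≤ L ^ k := Nat.one_le_pow _ _ (by omega)
  have hnr1 : (1 : ℝ) ≤ ((L ^ k : ℕ) : ℝ) := by exact_mod_cast hn1
  have hnr0 : (0 : ℝ) < ((L ^ k : ℕ) : ℝ) := by linarith
  set ρk : ℝ := ((L ^ k : ℕ) : ℝ) ^ (-(γ / 2)) with hρkdef
  have hρk0 : 0 ≤ ρk := Real.rpow_nonneg hnr0.le _
  -- the five letters at this index, decay weakened to the common rates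
  have hG := hasMaj_rate_mono hCG.le (min_le_left δG (min δD δ₁)) (HG mT k hk)
  have h0 := hasMaj_rate_mono (mul_nonneg hCD.le hρk0) ((min_le_right δG (min δD δ₁)).trans (min_le_left δD δ₁)) (H0 mT k r hk hL')
  have h1 := fun ν => hasMaj_rate_mono hC₁.le ((min_le_right δG (min δD δ₁)).trans (min_le_right δD δ₁)) (H1 mT k hk ν).1
  have hV := hasMaj_rate_mono hCΛ.le (min_le_left δΛ δLD) (HΛ k (L ^ r * L ^ k) (MP (paramsOf d L mT k hL')))
  have hDV := hasMaj_rate_mono (mul_nonneg hCLD.le hρk0) (min_le_right δΛ δLD) (HLD mT k r hk hL')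
  have hmain := hasMaj_idef_chiCube_nonlocal_neumannCubeG_of (r := r) (c := c) hS ha (triangle254_unitTorusGeo L k _) (rowSum_unitTorusGeo L k _ hσ) hCG.le
    (mul_nonneg hCD.le hρk0) hC₁.le hδ₀.le hCΛ.le (mul_nonneg hCLD.le hρk0) hρ.le (min_le_left _ _) (by linarith [min_le_right δ₀ (ρ₁ / 2), hρdef, hσdef]) hG h0 h1 hV hDV
  refine hmain.mono fun y y' => ?_
  have hI : 0 ≤ ind (g := unitTorusGeo L k (MP (paramsOf d L mT k hL'))) ((cubeBlocks (MP (paramsOf d L mT k hL')) c S : Finset _) : Set _) y *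
      ind (g := unitTorusGeo L k (MP (paramsOf d L mT k hL'))) ((cubeBlocks (MP (paramsOf d L mT k hL')) c S : Finset _) : Set _) y' :=
    mul_nonneg (ind_nonneg _ _) (ind_nonneg _ _)
  refine mul_le_mul_of_nonneg_left (mul_le_mul_of_nonneg_right ?_ (Real.exp_nonneg _)) hI
  -- `1∕L^k ≤ (L^k)^{−γ∕2}` and bookkeeping
  have hinv : 1 / ((L ^ k : ℕ) : ℝ) ≤ ρk := by
    rw [one_div, ← Real.rpow_neg_one]
    exact Real.rpow_le_rpow_of_exponent_le hnr1 (by linarith)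
  have t1 : (C₁ + 4 * CG) / ((L ^ k : ℕ) : ℝ) ≤ (C₁ + 4 * CG) * ρk := by
    rw [div_eq_mul_one_div]; exact mul_le_mul_of_nonneg_left hinv (by positivity)
  have t2 : (d + 1) * (C₁ / ((L ^ k : ℕ) : ℝ)) ≤ (d + 1) * C₁ * ρk := by
    rw [div_eq_mul_one_div, ← mul_assoc]; exact mul_le_mul_of_nonneg_left hinv (by positivity)
  have hρk1 : ρk ≤ 1 := by
    rw [hρkdef]; exact Real.rpow_le_one_of_one_le_of_nonpos hnr1 (by linarith)
  have p1 := mul_nonneg (by positivity : (0 : ℝ) ≤ a * (2 ^ (d + 1) * Real.exp δ₀ * (Real.exp δ₀ * Real.exp δ₀))) (sub_nonneg.mpr t1)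
  have p2 := mul_nonneg (by positivity : (0 : ℝ) ≤ 2 ^ (d + 1) * Real.exp δ₀ * cr * CΛ) (sub_nonneg.mpr t2)
  have p3 : 0 ≤ (1 : ℝ) * ρk := by positivity
  nlinarith [p1, p2, p3, hρk0, hcr, hCΛ.le, hCD.le, hC₁.le, hCG.le, hCLD.le]

/-- ★★★ **THE SAME IN dag-n15-c's FILE 77 SPELLING** (`HY`): torus `2L^{m+1}` (`MP (paramsOf d L (m+1) k hL)`), cube side `L·L^m`, any corner `c` (they specialise to `coverCorner …`), coarse
`n = L^k` (`k ≥ 1`), fine `L^r·L^k`, rate `(L^k)^{−γ∕2}` for any `0 < γ < 1` (their `(L^k)^{−1∕16}` is `γ = 1∕8`). [cite: Balaban1985BackgroundPropagators, Thm 3.14 pp.426–427, (3.42) p.397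
(shape); Balaban1984PropagatorsII, (2.37) p.229, (2.133)–(2.134) p.247; Balaban1984PropagatorsI, (1.18) p.20, (1.69)–(1.70) pp.29–30, (1.110) p.35, (1.126) p.38] -/
theorem hasMaj_idef_chiCube_nonlocal_neumannCubeG_succ (hLodd : Odd L) (hL2 : 2 ≤ L) {a : ℝ} (ha : 0 < a) {γ : ℝ} (hγ0 : 0 < γ) (hγ1 : γ < 1) :
    ∃ δ m : ℝ, 0 < δ ∧ 0 < m ∧ ∀ (m' k r : ℕ) (hk : 1 ≤ k) (hL : Odd L ∧ 1 < L) (c : Tor (MP (paramsOf d L (m' + 1) k hL))),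
      HasMaj (BlockNorm.ofBlocks (unitTorusGeo L k (MP (paramsOf d L (m' + 1) k hL))) (blkFine L k (MP (paramsOf d L (m' + 1) k hL))))
        (BlockNorm.ofBlocks (unitTorusGeo L k (MP (paramsOf d L (m' + 1) k hL)))
          (fun i : Tor (fine (L ^ r * L ^ k) (MP (paramsOf d L (m' + 1) k hL))) × Fin (d + 1) => blockOf (L ^ r * L ^ k) (MP (paramsOf d L (m' + 1) k hL)) i.1))
        (idef (pull (kingPrV L k r (MP (paramsOf d L (m' + 1) k hL)))) (pull (kingPrV L k r (MP (paramsOf d L (m' + 1) k hL))))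
          (mulOp (chiCube (MP (paramsOf d L (m' + 1) k hL)) (L ^ r * L ^ k) c (L * L ^ m')) ∘ₗ
            ((a • (qvAdjRe (MP (paramsOf d L (m' + 1) k hL)) (L ^ r * L ^ k) ∘ₗ qvRe (MP (paramsOf d L (m' + 1) k hL)) (L ^ r * L ^ k)) +
                (-landauRe (MP (paramsOf d L (m' + 1) k hL)) (L ^ r * L ^ k))) ∘ₗ
              neumannCubeG (MP (paramsOf d L (m' + 1) k hL)) (L ^ r * L ^ k) c (L * L ^ m') a))
          (mulOp (chiCube (MP (paramsOf d L (m' + 1) k hL)) (L ^ k) c (L * L ^ m')) ∘ₗ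
            ((a • (qvAdjRe (MP (paramsOf d L (m' + 1) k hL)) (L ^ k) ∘ₗ qvRe (MP (paramsOf d L (m' + 1) k hL)) (L ^ k)) +
                (-landauRe (MP (paramsOf d L (m' + 1) k hL)) (L ^ k))) ∘ₗ
              neumannCubeG (MP (paramsOf d L (m' + 1) k hL)) (L ^ k) c (L * L ^ m') a)))
        (fun y y' => ind ((cubeBlocks (MP (paramsOf d L (m' + 1) k hL)) c (L * L ^ m') : Finset _) : Set _) y *
          ind ((cubeBlocks (MP (paramsOf d L (m' + 1) k hL)) c (L * L ^ m') : Finset _) : Set _) y' *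
          (m * ((L ^ k : ℕ) : ℝ) ^ (-(γ / 2)) * Real.exp (-(δ * tdistT (MP (paramsOf d L (m' + 1) k hL)) y y')))) := by
  obtain ⟨δ, m, hδ, hm, H⟩ := hasMaj_idef_chiCube_nonlocal_neumannCubeG (d := d) hLodd hL2 ha hγ0 hγ1
  refine ⟨δ, m, hδ, hm, fun m' k r hk hL c => H (m' + 1) k r hk hL (L * L ^ m') (fun ν => ?_) c⟩
  show 2 * L ^ (m' + 1) = 2 * (L * L ^ m')
  rw [pow_succ']

end Family

end Summit.QuantumFields.YangMills.BalabanUVNodes.N15.TwoGrid
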